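import Mathlib
import Summits.Ventures.PercRepro2.RowC1DetHFresh

/-!
# The H-determinant inequality of row 2′C1 (blind cell PercRepro2, p2 g31)

With `Q = {a₁ ↮ a₂}`, `C₁ = C(a₁)`, `C₂ = C(a₂)`, `U = C₁ ∪ C₂` and `N = ∉ U` (a mark in no root
cluster), the **H-determinant** of the marks `b, o` is

  `det_H := P(Q, b ∈ C₂, o ∈ C₂) · P(Q, b ∉ U, o ∉ U) − P(Q, b ∈ C₂, o ∉ U) · P(Q, b ∉ U, o ∈ C₂)`.

**Theorem `detH_nonneg`: `det_H ≥ 0`.**  Equivalently (two indicators have nonnegative covariance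
iff their `2 × 2` table has nonnegative determinant): conditionally on `{a₁ ↮ a₂, a₁ ↮ b, a₁ ↮ o}`
the events `{b ↔ a₂}` and `{o ↔ a₂}` are positively correlated — BHK 1.1 with the conditioning
strengthened from `a₁ ↮ a₂` to `a₁ ↮ {a₂, b, o}`.

Proof.  Explore the cluster `K = C₁` of `a₁`; on `{a₁ ↮ {a₂, b, o}}` the cluster of `a₂` is its
cluster in the fresh graph `G ∖ K` (`prob_clusterIn_inter_eq_expect`).  With
`f(K) = P_{G∖K}(b ↔ a₂)`, `g(K) = P_{G∖K}(o ↔ a₂)` (`freshH`), Harris in `G ∖ K` gives, cluster by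
cluster, `P_{G∖K}(b, o ↔ a₂) ≥ f g`, `P_{G∖K}(b, o ↮ a₂) ≥ (1−f)(1−g)`, `P_{G∖K}(b ↔ a₂, o ↮ a₂) ≤
f(1−g)`, `P_{G∖K}(b ↮ a₂, o ↔ a₂) ≤ (1−f) g`, so with `R = {a₁ ↮ {a₂, b, o}}`
`det_H ≥ E[fg 1_R]·E[(1−f)(1−g) 1_R] − E[f(1−g) 1_R]·E[(1−f)g 1_R] = E[fg 1_R]·P(R) − E[f 1_R]·E[g 1_R]`,
and the last expression is nonnegative by the functional BHK inequality `bhk_induced` for the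
cluster of `a₁` with the avoidance set `X = {a₂, b, o}` and the nonnegative monotone cluster
functionals `1 − f`, `1 − g` (`f`, `g` are antitone in `K`: `delClusterProb_anti`).

Consequence (next file): row 2′C1, `P(Q, b ∈ C₂) P(Q, o ∈ U) ≤ P(Q) P(Q, b ∈ U, o ∈ U)`, has the exact
decomposition `P(Q) P(Q, bU, oU) − P(Q, bH) P(Q, oU) = det_H + det_L + P(Q, bH, oU) P(Q, bL) +
P(Q, bL, oU) P(Q, b ∉ H)`, so the row is equivalent to the nonnegativity of the remaining
"L-part".  Std axioms.
-/

namespace Summit.Ventures.PercRepro2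

namespace RowC1

section DetH

open Classical

variable {V : Type*} {E : Type*} [Fintype E] [DecidableEq E] [Fintype V] [DecidableEq V]
  {R : Type*} [CommRing R] [LinearOrder R] [IsStrictOrderedRing R]

/-! ### The four events of the determinant as exploration events -/

/-- The family `{K : b ∉ K ∧ o ∉ K}` of clusters of `a₁` avoiding both marks. -/
def avoidFam (o b : V) : Set (Set V) := {K : Set V | b ∉ K ∧ o ∉ K}

omit [Fintype E] [DecidableEq E] [Fintype V] [DecidableEq V] in
/-- On `Q`, `b ∈ C₂` forces `b ∉ C₁`. -/
lemma notMem_cluster_a₁_of_mem_a₂ {ends : E → Sym2 V} {ω : Config E} {a₁ a₂ x : V}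
    (hQ : ω ∈ (connEvent ends a₁ a₂)ᶜ) (hx : ω ∈ connEvent ends a₂ x) : x ∉ cluster ends ω a₁ :=
  fun h => hQ (conn_trans h (conn_symm hx))

omit [Fintype E] [DecidableEq E] [Fintype V] [DecidableEq V] in
/-- `{Q, b ∈ C₂, o ∈ C₂}` as an exploration event. -/
lemma ev_HH (ends : E → Sym2 V) (a₁ a₂ o b : V) :
    connEvent ends a₂ b ∩ connEvent ends a₂ o ∩ (connEvent ends a₁ a₂)ᶜ =
      clusterInEvent ends a₁ (avoidFam o b) ∩
        clusterInEvent ends a₂ {C : Set V | b ∈ C ∧ o ∈ C} ∩ (connEvent ends a₁ a₂)ᶜ := by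
  ext ω
  constructor
  · rintro ⟨⟨hb, ho⟩, hQ⟩
    exact ⟨⟨⟨notMem_cluster_a₁_of_mem_a₂ hQ hb, notMem_cluster_a₁_of_mem_a₂ hQ ho⟩, ⟨hb, ho⟩⟩, hQ⟩
  · rintro ⟨⟨-, ⟨hb, ho⟩⟩, hQ⟩
    exact ⟨⟨hb, ho⟩, hQ⟩

omit [Fintype E] [DecidableEq E] [Fintype V] [DecidableEq V] in
/-- `{Q, b ∉ U, o ∉ U}` as an exploration event. -/
lemma ev_NN (ends : E → Sym2 V) (a₁ a₂ o b : V) :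
    (connEvent ends a₁ b ∪ connEvent ends a₂ b)ᶜ ∩ (connEvent ends a₁ o ∪ connEvent ends a₂ o)ᶜ ∩
        (connEvent ends a₁ a₂)ᶜ =
      clusterInEvent ends a₁ (avoidFam o b) ∩
        clusterInEvent ends a₂ {C : Set V | b ∉ C ∧ o ∉ C} ∩ (connEvent ends a₁ a₂)ᶜ := by
  ext ω
  constructor
  · rintro ⟨⟨hb, ho⟩, hQ⟩
    exact ⟨⟨⟨fun h => hb (Or.inl h), fun h => ho (Or.inl h)⟩,
      ⟨fun h => hb (Or.inr h), fun h => ho (Or.inr h)⟩⟩, hQ⟩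
  · rintro ⟨⟨⟨hb1, ho1⟩, ⟨hb2, ho2⟩⟩, hQ⟩
    exact ⟨⟨fun h => h.elim hb1 hb2, fun h => h.elim ho1 ho2⟩, hQ⟩

omit [Fintype E] [DecidableEq E] [Fintype V] [DecidableEq V] in
/-- `{Q, b ∈ C₂, o ∉ U}` as an exploration event. -/
lemma ev_HN (ends : E → Sym2 V) (a₁ a₂ o b : V) :
    connEvent ends a₂ b ∩ (connEvent ends a₁ o ∪ connEvent ends a₂ o)ᶜ ∩
        (connEvent ends a₁ a₂)ᶜ =
      clusterInEvent ends a₁ (avoidFam o b) ∩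
        clusterInEvent ends a₂ {C : Set V | b ∈ C ∧ o ∉ C} ∩ (connEvent ends a₁ a₂)ᶜ := by
  ext ω
  constructor
  · rintro ⟨⟨hb, ho⟩, hQ⟩
    exact ⟨⟨⟨notMem_cluster_a₁_of_mem_a₂ hQ hb, fun h => ho (Or.inl h)⟩,
      ⟨hb, fun h => ho (Or.inr h)⟩⟩, hQ⟩
  · rintro ⟨⟨⟨-, ho1⟩, ⟨hb, ho2⟩⟩, hQ⟩
    exact ⟨⟨hb, fun h => h.elim ho1 ho2⟩, hQ⟩

omit [Fintype E] [DecidableEq E] [Fintype V] [DecidableEq V] in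
/-- `{Q, b ∉ U, o ∈ C₂}` as an exploration event. -/
lemma ev_NH (ends : E → Sym2 V) (a₁ a₂ o b : V) :
    (connEvent ends a₁ b ∪ connEvent ends a₂ b)ᶜ ∩ connEvent ends a₂ o ∩
        (connEvent ends a₁ a₂)ᶜ =
      clusterInEvent ends a₁ (avoidFam o b) ∩
        clusterInEvent ends a₂ {C : Set V | b ∉ C ∧ o ∈ C} ∩ (connEvent ends a₁ a₂)ᶜ := by
  ext ω
  constructor
  · rintro ⟨⟨hb, ho⟩, hQ⟩
    exact ⟨⟨⟨fun h => hb (Or.inl h), notMem_cluster_a₁_of_mem_a₂ hQ ho⟩,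
      ⟨fun h => hb (Or.inr h), ho⟩⟩, hQ⟩
  · rintro ⟨⟨⟨hb1, -⟩, ⟨hb2, ho⟩⟩, hQ⟩
    exact ⟨⟨fun h => h.elim hb1 hb2, ho⟩, hQ⟩

/-! ### The avoidance indicator and the BHK step -/

/-- `I(ω) = 1[b, o ∉ C₁]·1_Q(ω)`: the indicator of `{a₁ ↮ a₂, a₁ ↮ b, a₁ ↮ o}`. -/
noncomputable def avoidInd (ends : E → Sym2 V) (a₁ a₂ o b : V) (ω : Config E) : R :=
  (avoidFam o b).indicator 1 (cluster ends ω a₁) * ((connEvent ends a₁ a₂)ᶜ).indicator 1 ω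

omit [Fintype E] [DecidableEq E] [Fintype V] [DecidableEq V] in
/-- `0 ≤ I`. -/
lemma avoidInd_nonneg (ends : E → Sym2 V) (a₁ a₂ o b : V) (ω : Config E) :
    (0 : R) ≤ avoidInd ends a₁ a₂ o b ω :=
  mul_nonneg (Set.indicator_apply_nonneg fun _ => zero_le_one)
    (Set.indicator_apply_nonneg fun _ => zero_le_one)

omit [Fintype E] [DecidableEq E] [LinearOrder R] [IsStrictOrderedRing R] in
/-- `I` is the indicator of `R^{univ}_{{a₂, b, o}}` (the cluster of `a₁` avoids `a₂, b, o`). -/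
lemma REvent_indicator_eq_avoidInd (ends : E → Sym2 V) (a₁ a₂ o b : V) (ω : Config E) :
    (REvent ends Finset.univ a₁ {a₂, b, o}).indicator (1 : Config E → R) ω =
      avoidInd ends a₁ a₂ o b ω := by
  unfold avoidInd
  by_cases h : ω ∈ REvent ends Finset.univ a₁ {a₂, b, o}
  · rw [Set.indicator_of_mem h, Pi.one_apply]
    have h' : ∀ x ∈ ({a₂, b, o} : Finset V), ¬ Conn ends ω a₁ x := by
      intro x hx
      have := h x hx
      rwa [Finset.coe_univ, induced_univ] at this
    have hQ : ω ∈ (connEvent ends a₁ a₂)ᶜ := h' a₂ (by simp)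
    have hU : cluster ends ω a₁ ∈ avoidFam o b :=
      ⟨h' b (by simp), h' o (by simp)⟩
    rw [Set.indicator_of_mem hU, Set.indicator_of_mem hQ]
    simp
  · rw [Set.indicator_of_notMem h]
    by_cases hQ : ω ∈ (connEvent ends a₁ a₂)ᶜ
    · by_cases hU : cluster ends ω a₁ ∈ avoidFam o b
      · exfalso
        apply h
        intro x hx
        rw [Finset.coe_univ, induced_univ]
        simp only [Finset.mem_insert, Finset.mem_singleton] at hx
        rcases hx with rfl | rfl | rfl
        · exact hQ
        · exact hU.1
        · exact hU.2
      · rw [Set.indicator_of_notMem hU, zero_mul]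
    · rw [Set.indicator_of_notMem hQ, mul_zero]

/-- **The BHK step**: with `f = f_b(C₁)`, `g = f_o(C₁)` and `I` the avoidance indicator,
`E[f I]·E[g I] ≤ E[f g I]·E[I]`. -/
theorem bhk_avoid_step (p : E → R) (hp : IsProbVec p) (ends : E → Sym2 V) (a₁ a₂ o b : V) :
    expect p (fun ω => freshH p ends a₂ b (cluster ends ω a₁) * avoidInd ends a₁ a₂ o b ω) *
        expect p (fun ω => freshH p ends a₂ o (cluster ends ω a₁) * avoidInd ends a₁ a₂ o b ω) ≤
      expect p (fun ω => freshH p ends a₂ b (cluster ends ω a₁) *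
          freshH p ends a₂ o (cluster ends ω a₁) * avoidInd ends a₁ a₂ o b ω) *
        expect p (fun ω => avoidInd ends a₁ a₂ o b ω) := by
  -- the functionals `1 − f_b`, `1 − f_o` are nonnegative and monotone in the cluster
  have hF₁ : Monotone (fun K : Set V => 1 - freshH p ends a₂ b K) :=
    fun K K' h => sub_le_sub_left (freshH_anti p hp ends a₂ b h) 1
  have hF₂ : Monotone (fun K : Set V => 1 - freshH p ends a₂ o K) :=
    fun K K' h => sub_le_sub_left (freshH_anti p hp ends a₂ o h) 1
  have hF₁0 : ∀ K : Set V, 0 ≤ 1 - freshH p ends a₂ b K :=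
    fun K => sub_nonneg.2 (freshH_le_one p hp ends a₂ b K)
  have hF₂0 : ∀ K : Set V, 0 ≤ 1 - freshH p ends a₂ o K :=
    fun K => sub_nonneg.2 (freshH_le_one p hp ends a₂ o K)
  have h := bhk_induced p hp ends a₁ hF₁ hF₂ hF₁0 hF₂0 Finset.univ {a₂, b, o} {a₂, b, o}
    (Finset.subset_univ _) (Finset.subset_univ _)
  simp only [Finset.inter_self, Finset.union_self] at h
  -- rewrite the four terms with `I`
  have e1 : ∀ F : Set V → R, clusterObs ends Finset.univ a₁ F *
      (REvent ends Finset.univ a₁ {a₂, b, o}).indicator 1 =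
      fun ω => F (cluster ends ω a₁) * avoidInd ends a₁ a₂ o b ω := by
    intro F
    funext ω
    simp only [Pi.mul_apply, clusterObs_apply, clusterIn_univ, REvent_indicator_eq_avoidInd]
  have e2 : prob p (REvent ends Finset.univ a₁ {a₂, b, o}) =
      expect p (fun ω => avoidInd ends a₁ a₂ o b ω) := by
    rw [prob_eq_expect_indicator]
    unfold expect
    refine Finset.sum_congr rfl fun ω _ => ?_
    rw [REvent_indicator_eq_avoidInd]
  rw [e1, e1, e1, e2] at h
  simp only [Pi.mul_apply] at h
  -- expand the products
  have ef : expect p (fun ω => (1 - freshH p ends a₂ b (cluster ends ω a₁)) *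
      avoidInd ends a₁ a₂ o b ω) = expect p (fun ω => avoidInd ends a₁ a₂ o b ω) -
      expect p (fun ω => freshH p ends a₂ b (cluster ends ω a₁) * avoidInd ends a₁ a₂ o b ω) :=
    expect_one_sub_mul p _ _
  have eg : expect p (fun ω => (1 - freshH p ends a₂ o (cluster ends ω a₁)) *
      avoidInd ends a₁ a₂ o b ω) = expect p (fun ω => avoidInd ends a₁ a₂ o b ω) -
      expect p (fun ω => freshH p ends a₂ o (cluster ends ω a₁) * avoidInd ends a₁ a₂ o b ω) :=
    expect_one_sub_mul p _ _
  have efg : expect p (fun ω => (1 - freshH p ends a₂ b (cluster ends ω a₁)) *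
      (1 - freshH p ends a₂ o (cluster ends ω a₁)) * avoidInd ends a₁ a₂ o b ω) =
      expect p (fun ω => avoidInd ends a₁ a₂ o b ω) -
      expect p (fun ω => freshH p ends a₂ b (cluster ends ω a₁) * avoidInd ends a₁ a₂ o b ω) -
      expect p (fun ω => freshH p ends a₂ o (cluster ends ω a₁) * avoidInd ends a₁ a₂ o b ω) +
      expect p (fun ω => freshH p ends a₂ b (cluster ends ω a₁) *
        freshH p ends a₂ o (cluster ends ω a₁) * avoidInd ends a₁ a₂ o b ω) :=
    expect_one_sub_mul_one_sub_mul p _ _ _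
  rw [ef, eg, efg] at h
  nlinarith [h]

/-! ### The theorem -/

/-- **The H-determinant of row 2′C1 is nonnegative**:
`P(Q, b ∈ C₂, o ∉ U) · P(Q, b ∉ U, o ∈ C₂) ≤ P(Q, b ∈ C₂, o ∈ C₂) · P(Q, b ∉ U, o ∉ U)`
(`Q = {a₁ ↮ a₂}`, `U = C₁ ∪ C₂`).  Equivalently, `{b ↔ a₂}` and `{o ↔ a₂}` are positively
correlated conditionally on `{a₁ ↮ a₂, a₁ ↮ b, a₁ ↮ o}`. -/
theorem detH_nonneg (p : E → R) (hp : IsProbVec p) (ends : E → Sym2 V) (a₁ a₂ o b : V) :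
    prob p (connEvent ends a₂ b ∩ (connEvent ends a₁ o ∪ connEvent ends a₂ o)ᶜ ∩
          (connEvent ends a₁ a₂)ᶜ) *
        prob p ((connEvent ends a₁ b ∪ connEvent ends a₂ b)ᶜ ∩ connEvent ends a₂ o ∩
          (connEvent ends a₁ a₂)ᶜ) ≤
      prob p (connEvent ends a₂ b ∩ connEvent ends a₂ o ∩ (connEvent ends a₁ a₂)ᶜ) *
        prob p ((connEvent ends a₁ b ∪ connEvent ends a₂ b)ᶜ ∩
          (connEvent ends a₁ o ∪ connEvent ends a₂ o)ᶜ ∩ (connEvent ends a₁ a₂)ᶜ) := by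
  -- the four terms by exploration of the cluster of `a₁`
  rw [ev_HH, ev_NN, ev_HN, ev_NH, prob_clusterIn_inter_eq_expect, prob_clusterIn_inter_eq_expect,
    prob_clusterIn_inter_eq_expect, prob_clusterIn_inter_eq_expect]
  have hI0 : ∀ ω, (0 : R) ≤ (avoidFam o b).indicator 1 (cluster ends ω a₁) *
      ((connEvent ends a₁ a₂)ᶜ).indicator 1 ω := fun ω => avoidInd_nonneg ends a₁ a₂ o b ω
  have hf0 : ∀ ω, 0 ≤ freshH p ends a₂ b (cluster ends ω a₁) :=
    fun ω => freshH_nonneg p hp ends a₂ b _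
  have hg0 : ∀ ω, 0 ≤ freshH p ends a₂ o (cluster ends ω a₁) :=
    fun ω => freshH_nonneg p hp ends a₂ o _
  have hf1 : ∀ ω, freshH p ends a₂ b (cluster ends ω a₁) ≤ 1 :=
    fun ω => freshH_le_one p hp ends a₂ b _
  have hg1 : ∀ ω, freshH p ends a₂ o (cluster ends ω a₁) ≤ 1 :=
    fun ω => freshH_le_one p hp ends a₂ o _
  -- the four bounds, cluster by cluster
  have hA : expect p (fun ω => freshH p ends a₂ b (cluster ends ω a₁) *
        freshH p ends a₂ o (cluster ends ω a₁) * avoidInd ends a₁ a₂ o b ω) ≤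
      expect p (fun ω => (avoidFam o b).indicator 1 (cluster ends ω a₁) *
        delClusterProb p ends a₂ {C : Set V | b ∈ C ∧ o ∈ C} (cluster ends ω a₁) *
        ((connEvent ends a₁ a₂)ᶜ).indicator 1 ω) := by
    refine expect_mono hp fun ω => ?_
    have h1 := fresh_both_ge p hp ends a₂ o b (cluster ends ω a₁)
    unfold avoidInd
    nlinarith [mul_le_mul_of_nonneg_right h1 (hI0 ω)]
  have hD : expect p (fun ω => (1 - freshH p ends a₂ b (cluster ends ω a₁)) *
        (1 - freshH p ends a₂ o (cluster ends ω a₁)) * avoidInd ends a₁ a₂ o b ω) ≤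
      expect p (fun ω => (avoidFam o b).indicator 1 (cluster ends ω a₁) *
        delClusterProb p ends a₂ {C : Set V | b ∉ C ∧ o ∉ C} (cluster ends ω a₁) *
        ((connEvent ends a₁ a₂)ᶜ).indicator 1 ω) := by
    refine expect_mono hp fun ω => ?_
    have h1 := fresh_neither_ge p hp ends a₂ o b (cluster ends ω a₁)
    unfold avoidInd
    nlinarith [mul_le_mul_of_nonneg_right h1 (hI0 ω)]
  have hB : expect p (fun ω => (avoidFam o b).indicator 1 (cluster ends ω a₁) *
        delClusterProb p ends a₂ {C : Set V | b ∈ C ∧ o ∉ C} (cluster ends ω a₁) *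
        ((connEvent ends a₁ a₂)ᶜ).indicator 1 ω) ≤
      expect p (fun ω => freshH p ends a₂ b (cluster ends ω a₁) *
        (1 - freshH p ends a₂ o (cluster ends ω a₁)) * avoidInd ends a₁ a₂ o b ω) := by
    refine expect_mono hp fun ω => ?_
    have h1 := fresh_b_in_o_out_le p hp ends a₂ o b (cluster ends ω a₁)
    unfold avoidInd
    nlinarith [mul_le_mul_of_nonneg_right h1 (hI0 ω)]
  have hC : expect p (fun ω => (avoidFam o b).indicator 1 (cluster ends ω a₁) *
        delClusterProb p ends a₂ {C : Set V | b ∉ C ∧ o ∈ C} (cluster ends ω a₁) *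
        ((connEvent ends a₁ a₂)ᶜ).indicator 1 ω) ≤
      expect p (fun ω => (1 - freshH p ends a₂ b (cluster ends ω a₁)) *
        freshH p ends a₂ o (cluster ends ω a₁) * avoidInd ends a₁ a₂ o b ω) := by
    refine expect_mono hp fun ω => ?_
    have h1 := fresh_b_out_o_in_le p hp ends a₂ o b (cluster ends ω a₁)
    unfold avoidInd
    nlinarith [mul_le_mul_of_nonneg_right h1 (hI0 ω)]
  -- nonnegativity of everything in sight
  have hI0' : ∀ ω, (0 : R) ≤ avoidInd ends a₁ a₂ o b ω := fun ω => avoidInd_nonneg ends a₁ a₂ o b ω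
  have ind0 : ∀ (𝓥 : Set (Set V)) (ω : Config E), (0 : R) ≤
      (avoidFam o b).indicator 1 (cluster ends ω a₁) * delClusterProb p ends a₂ 𝓥 (cluster ends ω a₁) *
        ((connEvent ends a₁ a₂)ᶜ).indicator 1 ω := fun 𝓥 ω =>
    mul_nonneg (mul_nonneg (Set.indicator_apply_nonneg fun _ => zero_le_one)
      (delClusterProb_nonneg p hp ends a₂ 𝓥 _)) (Set.indicator_apply_nonneg fun _ => zero_le_one)
  have nA := expect_nonneg hp (ind0 {C : Set V | b ∈ C ∧ o ∈ C})
  have nB := expect_nonneg hp (ind0 {C : Set V | b ∈ C ∧ o ∉ C})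
  have nC := expect_nonneg hp (ind0 {C : Set V | b ∉ C ∧ o ∈ C})
  have nD' : 0 ≤ expect p (fun ω => (1 - freshH p ends a₂ b (cluster ends ω a₁)) *
      (1 - freshH p ends a₂ o (cluster ends ω a₁)) * avoidInd ends a₁ a₂ o b ω) :=
    expect_nonneg hp fun ω => mul_nonneg (mul_nonneg (sub_nonneg.2 (hf1 ω)) (sub_nonneg.2 (hg1 ω)))
      (hI0' ω)
  have nB' : 0 ≤ expect p (fun ω => freshH p ends a₂ b (cluster ends ω a₁) *
      (1 - freshH p ends a₂ o (cluster ends ω a₁)) * avoidInd ends a₁ a₂ o b ω) :=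
    expect_nonneg hp fun ω => mul_nonneg (mul_nonneg (hf0 ω) (sub_nonneg.2 (hg1 ω))) (hI0' ω)
  -- the expansions of the primed terms
  have eD' := expect_one_sub_mul_one_sub_mul p (fun ω => freshH p ends a₂ b (cluster ends ω a₁))
    (fun ω => freshH p ends a₂ o (cluster ends ω a₁)) (fun ω => avoidInd ends a₁ a₂ o b ω)
  have eB' := expect_mul_one_sub_mul p (fun ω => freshH p ends a₂ b (cluster ends ω a₁))
    (fun ω => freshH p ends a₂ o (cluster ends ω a₁)) (fun ω => avoidInd ends a₁ a₂ o b ω)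
  have eC' := expect_one_sub_mul_mul p (fun ω => freshH p ends a₂ b (cluster ends ω a₁))
    (fun ω => freshH p ends a₂ o (cluster ends ω a₁)) (fun ω => avoidInd ends a₁ a₂ o b ω)
  -- the BHK step
  have key := bhk_avoid_step p hp ends a₁ a₂ o b
  -- assemble
  have hAD := mul_le_mul hA hD nD' nA
  have hBC := mul_le_mul hB hC nC nB'
  rw [eD'] at hAD
  rw [eB', eC'] at hBC
  nlinarith [hAD, hBC, key]

end DetH

end RowC1

end Summit.Ventures.PercRepro2
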